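import Summits.CriticalPhenomena.PercolationContinuityZ3.Theorems.PercNearOneGluingNoHeavyQuantThreePortHTiles
import Summits.CriticalPhenomena.PercolationContinuityZ3.Theorems.PercNearOneGluingNoHeavyQuantThreePortH
import Summits.CriticalPhenomena.PercolationContinuityZ3.Theorems.PercNearOneGluingNoHeavyQuantThreePortFinalMap
import HarnessLib

/-!
# `Z(3,2)` AT EVERY THREE-PORT OBSERVER FROM THE LINEAR THREE-CLUSTER ROW H_{1/3}

builds on p205010 (kernel theorem, internal audit signed; external expert review pending)

Support file (`--supports stmt-CriticalPhenomena-4575`), seat `prim-quant-p1` (gen 39); memo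
`run/shared/lean/prim/quant/prim-quant-p1-g39/FOR-LEAD-Z32-HCOLLAR.md`.  No definitions, no named facts, no sorries; standard axioms.

SETTING (`ThreePort`).  A three-port observer `o` (all positive pairs of `o` go to `a, b, c`; hairs `α, β, γ`) of an ARBITRARY finite
weighted graph; `Z(3,2)` at `o` is `Σ_v μ(o↔v) > 2, μ(o↮v) ≤ t (v = a,b,c) ⟹ μ{o reaches ≤ 1 of a,b,c} ≤ t` (`OneCutFive.ZeroOneThree`
at `o`, = FAR(1) at `|A| = 3`).  p1 g3–g5 proved it from the rows then known (exchanges, Gladkov–Zimin, Gladkov L1.2, the mean) on the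
FINAL-MAP region (`le_one_reached_le_threePort`, p229669: a hair `≥ ½`, or all `≥ 3/10`, or all `≤ 2/5`, or all margins `V_v ≥ 1/40`)
and showed that on the complement — the COLLAR — those rows admit an abstract witness (`lens_witness`, p227599).  p1 g38 identified the
missing realizability input as the LINEAR THREE-CLUSTER ROW (conjecture H_κ, `κ* ≈ 0.835`; Gladkov 2024 Thm 1.3 is its qualitative shadow)
  (H_κ, apex `a`)  `κ · P(a ↔ {b,c}) · P(b ↮ c) ≤ P({a↔b ∨ a↔c} ∩ {b↮c})`  off `o`,
and landed the interface `le_one_reached_le_of_cellSolverH` (p551940).  THIS FILE closes the collar: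
* `ThreePort.hCollar_residual_false_sorted` / `hCollar_residual_false` — pure real algebra: on the collar (all hairs `≤ ½`, some hair
  `> 2/5`, some hair `< 3/10`, some margin `< 1/40`) the residual system {cells, the three failed exchanges, H_κ at the three apexes,
  `Σ > 2`} is contradictory for every `κ ≥ 1/3` (sorted frame: the tiling `hCollar_tile_false`; six orders by relabelling).  Only the caps
  at the two lighter hairs, H at the apex of the heaviest hair and the mean are used: the caps give `Uab + Uac ≤ R·U0`, H gives
  `P(a attached) ≤ R/(κ(1+R))` (rarely attached), the mean gives `P(a attached) > (m−1)/(m−q)` (often attached).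
* **`ThreePort.le_one_reached_le_of_H`** — `Z(3,2)` AT EVERY THREE-PORT OBSERVER OF EVERY FINITE WEIGHTED GRAPH whose off-`o`
  three-point law of `(a,b,c)` satisfies the three rows H_κ for some `κ ≥ 1/3` (no hypothesis on the hairs): final map ∪ collar.
So the three-port case of `Z(3,2)` is reduced to H_{1/3}, a factor `2.5` below the conjectured constant; numerically the abstract system
needs `κ ≳ 0.18` on the collar (memo §2), so `1/3` is within a factor 2 of what ANY cell solver can extract from these rows.
[cite: Gladkov2024, Thm. 1.3 (p. 2), Conj. 10.1 (p. 18), arXiv:2408.08457]; [cite: GladkovZimin2024, Thm. 4.6]; [cite: KozmaNitzan2024, Lemma 2 (p. 6)] (context).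
-/

noncomputable section

namespace Summit.CriticalPhenomena.PercolationContinuityZ3.Theorems

open MeasureTheory Set Literature.Probability.LatticeModels Literature.Probability.Percolation
open scoped Classical BigOperators

variable {n : ℕ}

namespace ThreePort

/-! ### Pure real algebra: the collar -/

/-- **Sorted frame.**  `γ ≤ β ≤ α ≤ ½` with the collar conditions in symmetric form (some hair `> 2/5`, some hair `< 3/10`, some
margin `< 1/40` — in the sorted frame these are `α > 2/5`, `γ < 3/10`, `V_a < 1/40` since `V_a ≤ V_b ≤ V_c`): cells, the failed
exchanges at `b, c`, H_κ at `a` (`κ ≥ 1/3`) and `Σ > 2` are contradictory (`hCollar_tile_false`). [this work] -/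
theorem hCollar_residual_false_sorted (κ α β γ U0 Uab Uac Ubc U3 : ℝ) (hκ : 1 / 3 ≤ κ)
    (hα1 : α ≤ 1 / 2) (hγ0 : 0 ≤ γ) (hba : β ≤ α) (hcb : γ ≤ β)
    (hbig : 2 / 5 < α ∨ 2 / 5 < β ∨ 2 / 5 < γ) (hsmall : α < 3 / 10 ∨ β < 3 / 10 ∨ γ < 3 / 10)
    (hmargin : β + γ - β * γ < α + 1 / 40 ∨ α + γ - α * γ < β + 1 / 40 ∨ α + β - α * β < γ + 1 / 40)
    (h0 : 0 ≤ U0) (hab : 0 ≤ Uab) (hac : 0 ≤ Uac) (hbc : 0 ≤ Ubc) (h3 : 0 ≤ U3)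
    (hsum : Uab + Uac + Ubc + U3 + U0 = 1)
    (gb : U0 * ((1 - β) * α * γ - β * (1 - α) * (1 - γ)) + Uac * (α + γ - α * γ - β) < 0)
    (gc : U0 * ((1 - γ) * α * β - γ * (1 - α) * (1 - β)) + Uab * (α + β - α * β - γ) < 0)
    (hHa : κ * (Uab + Uac + U3) * (U0 + Uab + Uac) ≤ Uab + Uac)
    (hSig : 2 < (α + β + γ) + (α + β - 2 * α * β) * Uab + (α + γ - 2 * α * γ) * Uac + (β + γ - 2 * β * γ) * Ubc +
      ((1 - α) * (β + γ - β * γ) + (1 - β) * (α + γ - α * γ) + (1 - γ) * (α + β - α * β)) * U3) : False := by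
  have a1 : 2 / 5 ≤ α := by rcases hbig with h | h | h <;> linarith only [h, hba, hcb]
  have c2 : γ ≤ 3 / 10 := by rcases hsmall with h | h | h <;> linarith only [h, hba, hcb]
  have hVa : β + γ - β * γ - α < 1 / 40 := by
    rcases hmargin with h | h | h
    · linarith only [h]
    · -- `V_b − V_a = (α − β)(2 − γ)`
      have : 0 ≤ (α - β) * (2 - γ) := mul_nonneg (by linarith only [hba]) (by linarith only [hcb, hba, hα1])
      nlinarith only [h, this]
    · -- `V_c − V_a = (α − γ)(2 − β)`
      have : 0 ≤ (α - γ) * (2 - β) := mul_nonneg (by linarith only [hba, hcb]) (by linarith only [hba, hα1])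
      nlinarith only [h, this]
  exact hCollar_tile_false κ α β γ U0 Uab Uac Ubc U3 hκ a1 hα1 (hγ0.trans hcb) (hba.trans hα1) hγ0 c2 hcb hVa h0 hab hac
    hbc h3 hsum gb gc hHa hSig

/-- **Pure real algebra on the whole collar** (hairs in `[0, ½]`, some hair `> 2/5`, some `< 3/10`, some margin `< 1/40`): nonnegative
cells summing to `1`, the three failed exchanges, the three linear three-cluster rows H_κ (`κ ≥ 1/3`, `a`-dictionary of
`le_one_reached_le_of_cellSolverH`) and `Σ_v μ(o↔v) > 2` are contradictory: relabel so that the hairs are sorted. [this work] -/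
theorem hCollar_residual_false (κ α β γ U0 Uab Uac Ubc U3 : ℝ) (hκ : 1 / 3 ≤ κ)
    (hα0 : 0 ≤ α) (hα1 : α ≤ 1 / 2) (hβ0 : 0 ≤ β) (hβ1 : β ≤ 1 / 2) (hγ0 : 0 ≤ γ) (hγ1 : γ ≤ 1 / 2)
    (hbig : 2 / 5 < α ∨ 2 / 5 < β ∨ 2 / 5 < γ) (hsmall : α < 3 / 10 ∨ β < 3 / 10 ∨ γ < 3 / 10)
    (hmargin : β + γ - β * γ < α + 1 / 40 ∨ α + γ - α * γ < β + 1 / 40 ∨ α + β - α * β < γ + 1 / 40)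
    (h0 : 0 ≤ U0) (hab : 0 ≤ Uab) (hac : 0 ≤ Uac) (hbc : 0 ≤ Ubc) (h3 : 0 ≤ U3)
    (hsum : Uab + Uac + Ubc + U3 + U0 = 1)
    (ga : U0 * ((1 - α) * β * γ - α * (1 - β) * (1 - γ)) + Ubc * (β + γ - β * γ - α) < 0)
    (gb : U0 * ((1 - β) * α * γ - β * (1 - α) * (1 - γ)) + Uac * (α + γ - α * γ - β) < 0)
    (gc : U0 * ((1 - γ) * α * β - γ * (1 - α) * (1 - β)) + Uab * (α + β - α * β - γ) < 0)
    (hHa : κ * (Uab + Uac + U3) * (U0 + Uab + Uac) ≤ Uab + Uac)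
    (hHb : κ * (Uab + Ubc + U3) * (U0 + Uab + Ubc) ≤ Uab + Ubc)
    (hHc : κ * (Uac + Ubc + U3) * (U0 + Uac + Ubc) ≤ Uac + Ubc)
    (hSig : 2 < (α + β + γ) + (α + β - 2 * α * β) * Uab + (α + γ - 2 * α * γ) * Uac + (β + γ - 2 * β * γ) * Ubc +
      ((1 - α) * (β + γ - β * γ) + (1 - β) * (α + γ - α * γ) + (1 - γ) * (α + β - α * β)) * U3) : False := by
  rcases le_total β α with hβα | hαβ
  · rcases le_total γ β with hγβ | hβγ
    · -- `γ ≤ β ≤ α`: identity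
      exact hCollar_residual_false_sorted κ α β γ U0 Uab Uac Ubc U3 hκ hα1 hγ0 hβα hγβ hbig hsmall hmargin h0 hab hac hbc
        h3 hsum gb gc hHa hSig
    · rcases le_total γ α with hγα | hαγ
      · -- `β ≤ γ ≤ α`: roles `(a, c, b)`
        have hm : γ + β - γ * β < α + 1 / 40 ∨ α + β - α * β < γ + 1 / 40 ∨ α + γ - α * γ < β + 1 / 40 := by
          rcases hmargin with h | h | h
          · exact Or.inl (by linarith only [h])
          · exact Or.inr (Or.inr h)
          · exact Or.inr (Or.inl h)
        exact hCollar_residual_false_sorted κ α γ β U0 Uac Uab Ubc U3 hκ hα1 hβ0 hγα hβγ (hbig.imp_right Or.symm)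
          (hsmall.imp_right Or.symm) hm h0 hac hab hbc h3 (by linarith only [hsum]) (by linarith only [gc])
          (by linarith only [gb]) (by linarith only [hHa]) (by linarith only [hSig])
      · -- `β ≤ α ≤ γ`: roles `(c, a, b)`
        have hm : α + β - α * β < γ + 1 / 40 ∨ γ + β - γ * β < α + 1 / 40 ∨ γ + α - γ * α < β + 1 / 40 := by
          rcases hmargin with h | h | h
          · exact Or.inr (Or.inl (by linarith only [h]))
          · exact Or.inr (Or.inr (by linarith only [h]))
          · exact Or.inl h
        exact hCollar_residual_false_sorted κ γ α β U0 Uac Ubc Uab U3 hκ hγ1 hβ0 hαγ hβα hbig.rotate.rotate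
          hsmall.rotate.rotate hm h0 hac hbc hab h3 (by linarith only [hsum]) (by linarith only [ga])
          (by linarith only [gb]) (by linarith only [hHc]) (by linarith only [hSig])
  · rcases le_total γ α with hγα | hαγ
    · -- `γ ≤ α ≤ β`: roles `(b, a, c)`
      have hm : α + γ - α * γ < β + 1 / 40 ∨ β + γ - β * γ < α + 1 / 40 ∨ β + α - β * α < γ + 1 / 40 := by
        rcases hmargin with h | h | h
        · exact Or.inr (Or.inl h)
        · exact Or.inl h
        · exact Or.inr (Or.inr (by linarith only [h]))
      exact hCollar_residual_false_sorted κ β α γ U0 Uab Ubc Uac U3 hκ hβ1 hγ0 hαβ hγα (or_left_comm.mp hbig)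
        (or_left_comm.mp hsmall) hm h0 hab hbc hac h3 (by linarith only [hsum]) (by linarith only [ga])
        (by linarith only [gc]) (by linarith only [hHb]) (by linarith only [hSig])
    · rcases le_total γ β with hγβ | hβγ
      · -- `α ≤ γ ≤ β`: roles `(b, c, a)`
        have hm : γ + α - γ * α < β + 1 / 40 ∨ β + α - β * α < γ + 1 / 40 ∨ β + γ - β * γ < α + 1 / 40 := by
          rcases hmargin with h | h | h
          · exact Or.inr (Or.inr h)
          · exact Or.inl (by linarith only [h])
          · exact Or.inr (Or.inl (by linarith only [h]))
        exact hCollar_residual_false_sorted κ β γ α U0 Ubc Uab Uac U3 hκ hβ1 hα0 hγβ hαγ hbig.rotate hsmall.rotate hm h0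
          hbc hab hac h3 (by linarith only [hsum]) (by linarith only [gc]) (by linarith only [ga])
          (by linarith only [hHb]) (by linarith only [hSig])
      · -- `α ≤ β ≤ γ`: roles `(c, b, a)`
        have hm : β + α - β * α < γ + 1 / 40 ∨ γ + α - γ * α < β + 1 / 40 ∨ γ + β - γ * β < α + 1 / 40 := by
          rcases hmargin with h | h | h
          · exact Or.inr (Or.inr (by linarith only [h]))
          · exact Or.inr (Or.inl (by linarith only [h]))
          · exact Or.inl (by linarith only [h])
        exact hCollar_residual_false_sorted κ γ β α U0 Ubc Uac Uab U3 hκ hγ1 hα0 hβγ hαβ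
          (hbig.rotate.rotate.imp_right Or.symm) (hsmall.rotate.rotate.imp_right Or.symm) hm h0 hbc hac hab h3
          (by linarith only [hsum]) (by linarith only [gb]) (by linarith only [ga]) (by linarith only [hHc])
          (by linarith only [hSig])

/-! ### The theorem at a three-port observer -/

/-- **`Z(3,2)` at every three-port observer from the linear three-cluster row H_κ, `κ ≥ 1/3`.**  Let `o` be a three-port observer
onto `a, b, c` (pairs at `o` other than `o–a, o–b, o–c` have weight `0`) of an arbitrary finite weighted graph, and suppose the
off-`o` three-point law of `(a, b, c)` satisfies the three linear three-cluster rows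
`κ · P(v ↔ {u,w}) · P(u ↮ w) ≤ P({v↔u ∨ v↔w} ∩ {u↮w})` (apexes `v = a, b, c`, connections in `ω ∖ {edges at o}`) for some
`κ ≥ 1/3`.  If `Σ_v μ(o↔v) > 2` and `t ≥ μ(o↮v)` for `v = a, b, c`, then `μ{o reaches at most one of a, b, c} ≤ t`.
Final map (`le_one_reached_le_threePort`) off the collar; on the collar the cell solver `hCollar_residual_false` through
`le_one_reached_le_of_cellSolverH`. [this work] -/
theorem le_one_reached_le_of_H (κ : ℝ) (hκ : 1 / 3 ≤ κ) (w : Sym2 (Fin n) → unitInterval) (R : Finset (Fin n))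
    (o a b c : Fin n) (t : ℝ)
    (hR : R = {a, b, c}) (hao : a ≠ o) (hbo : b ≠ o) (hco : c ≠ o) (hab : a ≠ b) (hac : a ≠ c) (hbc : b ≠ c)
    (hobs : ∀ u, u ≠ o → u ≠ a → u ≠ b → u ≠ c → w s(o, u) = 0)
    (hHa : κ * ((prodBernoulli w).real {ω | (openGraph (ω ∩ {e | o ∉ e})).Reachable a b ∧ ¬ (openGraph (ω ∩ {e | o ∉ e})).Reachable a c} +
        (prodBernoulli w).real {ω | (openGraph (ω ∩ {e | o ∉ e})).Reachable a c ∧ ¬ (openGraph (ω ∩ {e | o ∉ e})).Reachable a b} +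
        (prodBernoulli w).real {ω | (openGraph (ω ∩ {e | o ∉ e})).Reachable a b ∧ (openGraph (ω ∩ {e | o ∉ e})).Reachable a c}) *
      ((prodBernoulli w).real {ω | ¬ (openGraph (ω ∩ {e | o ∉ e})).Reachable a b ∧ ¬ (openGraph (ω ∩ {e | o ∉ e})).Reachable a c ∧ ¬ (openGraph (ω ∩ {e | o ∉ e})).Reachable b c} +
        (prodBernoulli w).real {ω | (openGraph (ω ∩ {e | o ∉ e})).Reachable a b ∧ ¬ (openGraph (ω ∩ {e | o ∉ e})).Reachable a c} +
        (prodBernoulli w).real {ω | (openGraph (ω ∩ {e | o ∉ e})).Reachable a c ∧ ¬ (openGraph (ω ∩ {e | o ∉ e})).Reachable a b}) ≤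
      (prodBernoulli w).real {ω | (openGraph (ω ∩ {e | o ∉ e})).Reachable a b ∧ ¬ (openGraph (ω ∩ {e | o ∉ e})).Reachable a c} +
        (prodBernoulli w).real {ω | (openGraph (ω ∩ {e | o ∉ e})).Reachable a c ∧ ¬ (openGraph (ω ∩ {e | o ∉ e})).Reachable a b})
    (hHb : κ * ((prodBernoulli w).real {ω | (openGraph (ω ∩ {e | o ∉ e})).Reachable a b ∧ ¬ (openGraph (ω ∩ {e | o ∉ e})).Reachable a c} +
        (prodBernoulli w).real {ω | (openGraph (ω ∩ {e | o ∉ e})).Reachable b c ∧ ¬ (openGraph (ω ∩ {e | o ∉ e})).Reachable a b} +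
        (prodBernoulli w).real {ω | (openGraph (ω ∩ {e | o ∉ e})).Reachable a b ∧ (openGraph (ω ∩ {e | o ∉ e})).Reachable a c}) *
      ((prodBernoulli w).real {ω | ¬ (openGraph (ω ∩ {e | o ∉ e})).Reachable a b ∧ ¬ (openGraph (ω ∩ {e | o ∉ e})).Reachable a c ∧ ¬ (openGraph (ω ∩ {e | o ∉ e})).Reachable b c} +
        (prodBernoulli w).real {ω | (openGraph (ω ∩ {e | o ∉ e})).Reachable a b ∧ ¬ (openGraph (ω ∩ {e | o ∉ e})).Reachable a c} +
        (prodBernoulli w).real {ω | (openGraph (ω ∩ {e | o ∉ e})).Reachable b c ∧ ¬ (openGraph (ω ∩ {e | o ∉ e})).Reachable a b}) ≤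
      (prodBernoulli w).real {ω | (openGraph (ω ∩ {e | o ∉ e})).Reachable a b ∧ ¬ (openGraph (ω ∩ {e | o ∉ e})).Reachable a c} +
        (prodBernoulli w).real {ω | (openGraph (ω ∩ {e | o ∉ e})).Reachable b c ∧ ¬ (openGraph (ω ∩ {e | o ∉ e})).Reachable a b})
    (hHc : κ * ((prodBernoulli w).real {ω | (openGraph (ω ∩ {e | o ∉ e})).Reachable a c ∧ ¬ (openGraph (ω ∩ {e | o ∉ e})).Reachable a b} +
        (prodBernoulli w).real {ω | (openGraph (ω ∩ {e | o ∉ e})).Reachable b c ∧ ¬ (openGraph (ω ∩ {e | o ∉ e})).Reachable a b} +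
        (prodBernoulli w).real {ω | (openGraph (ω ∩ {e | o ∉ e})).Reachable a b ∧ (openGraph (ω ∩ {e | o ∉ e})).Reachable a c}) *
      ((prodBernoulli w).real {ω | ¬ (openGraph (ω ∩ {e | o ∉ e})).Reachable a b ∧ ¬ (openGraph (ω ∩ {e | o ∉ e})).Reachable a c ∧ ¬ (openGraph (ω ∩ {e | o ∉ e})).Reachable b c} +
        (prodBernoulli w).real {ω | (openGraph (ω ∩ {e | o ∉ e})).Reachable a c ∧ ¬ (openGraph (ω ∩ {e | o ∉ e})).Reachable a b} +
        (prodBernoulli w).real {ω | (openGraph (ω ∩ {e | o ∉ e})).Reachable b c ∧ ¬ (openGraph (ω ∩ {e | o ∉ e})).Reachable a b}) ≤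
      (prodBernoulli w).real {ω | (openGraph (ω ∩ {e | o ∉ e})).Reachable a c ∧ ¬ (openGraph (ω ∩ {e | o ∉ e})).Reachable a b} +
        (prodBernoulli w).real {ω | (openGraph (ω ∩ {e | o ∉ e})).Reachable b c ∧ ¬ (openGraph (ω ∩ {e | o ∉ e})).Reachable a b})
    (hsum : 2 < (prodBernoulli w).real (openConn o a) + (prodBernoulli w).real (openConn o b) +
      (prodBernoulli w).real (openConn o c))
    (hta : (prodBernoulli w).real (openConn o a)ᶜ ≤ t) (htb : (prodBernoulli w).real (openConn o b)ᶜ ≤ t)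
    (htc : (prodBernoulli w).real (openConn o c)ᶜ ≤ t) :
    (prodBernoulli w).real {ω : BondConfig (Fin n) | (R.filter fun v => ω ∈ openConn o v).card ≤ 1} ≤ t := by
  -- the final-map region (p1 g5)
  by_cases hhalf : (1 / 2 : ℝ) ≤ w s(o, a) ∨ (1 / 2 : ℝ) ≤ w s(o, b) ∨ (1 / 2 : ℝ) ≤ w s(o, c)
  · exact le_one_reached_le_threePort w R o a b c t hR hao hbo hco hab hac hbc hobs (Or.inl hhalf) hsum hta htb htc
  by_cases hlo : (3 / 10 : ℝ) ≤ w s(o, a) ∧ (3 / 10 : ℝ) ≤ w s(o, b) ∧ (3 / 10 : ℝ) ≤ w s(o, c)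
  · exact le_one_reached_le_threePort w R o a b c t hR hao hbo hco hab hac hbc hobs (Or.inr (Or.inl hlo)) hsum hta htb htc
  by_cases hhi : (w s(o, a) : ℝ) ≤ 2 / 5 ∧ (w s(o, b) : ℝ) ≤ 2 / 5 ∧ (w s(o, c) : ℝ) ≤ 2 / 5
  · exact le_one_reached_le_threePort w R o a b c t hR hao hbo hco hab hac hbc hobs (Or.inr (Or.inr (Or.inl hhi))) hsum
      hta htb htc
  by_cases hV : (w s(o, a) : ℝ) + 1 / 40 ≤ w s(o, b) + w s(o, c) - w s(o, b) * w s(o, c) ∧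
      (w s(o, b) : ℝ) + 1 / 40 ≤ w s(o, a) + w s(o, c) - w s(o, a) * w s(o, c) ∧
      (w s(o, c) : ℝ) + 1 / 40 ≤ w s(o, a) + w s(o, b) - w s(o, a) * w s(o, b)
  · exact le_one_reached_le_threePort w R o a b c t hR hao hbo hco hab hac hbc hobs (Or.inr (Or.inr (Or.inr hV))) hsum
      hta htb htc
  -- the collar
  push Not at hhalf
  have hbig : (2 / 5 : ℝ) < w s(o, a) ∨ (2 / 5 : ℝ) < w s(o, b) ∨ (2 / 5 : ℝ) < w s(o, c) := by
    by_contra h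
    push Not at h
    exact hhi h
  have hsmall : (w s(o, a) : ℝ) < 3 / 10 ∨ (w s(o, b) : ℝ) < 3 / 10 ∨ (w s(o, c) : ℝ) < 3 / 10 := by
    by_contra h
    push Not at h
    exact hlo h
  have hmargin : (w s(o, b) : ℝ) + w s(o, c) - w s(o, b) * w s(o, c) < w s(o, a) + 1 / 40 ∨
      (w s(o, a) : ℝ) + w s(o, c) - w s(o, a) * w s(o, c) < w s(o, b) + 1 / 40 ∨
      (w s(o, a) : ℝ) + w s(o, b) - w s(o, a) * w s(o, b) < w s(o, c) + 1 / 40 := by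
    by_contra h
    push Not at h
    exact hV h
  exact le_one_reached_le_of_cellSolverH κ w R o a b c t hR hao hbo hco hab hac hbc hobs
    (fun U0 Uab Uac Ubc U3 h0 hab' hac' hbc' h3 hs ga gb gc _ _ _ hHa' hHb' hHc' hSig =>
      hCollar_residual_false κ _ _ _ U0 Uab Uac Ubc U3 hκ (w s(o, a)).2.1 hhalf.1.le (w s(o, b)).2.1 hhalf.2.1.le
        (w s(o, c)).2.1 hhalf.2.2.le hbig hsmall hmargin h0 hab' hac' hbc' h3 hs ga gb gc hHa' hHb' hHc' hSig)
    hHa hHb hHc hsum hta htb htc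

end ThreePort

end Summit.CriticalPhenomena.PercolationContinuityZ3.Theorems

end
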